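import Summits.QuantumFields.YangMills.Theorems.UnitScaleTiltProp7CornerCombH21EOfRows
import Summits.QuantumFields.YangMills.Theorems.UnitScaleTiltProp7CombTildRem2DuhamelT3
import Summits.QuantumFields.YangMills.Theorems.UnitScaleTiltProp7CombTildRem2HMcomb2OfCellRowT3
import Summits.QuantumFields.YangMills.Theorems.UnitScaleTiltProp7CombTildRem2HMcomb2MemberRowsT3
import HarnessLib

/-!
# `UnitScaleTiltProp7CombTildRem2HMcomb2MemberT3` — M-4b OF px18 g4's H2-1(E) MEMBER KNIT (LOCATE 2686e4bb §2 «M-4»; seam (β) with w3-20520 g12): **THE MEMBER INSTANTIATION —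
# `hMcomb₂` AT `RegPr` FROM THE COMB LEVEL MASSES `hMcomb` AND THE PER-LEVEL NORM-GAP ROWS (G_j), every other row read off `RegPr` + `In19`**
(route `UnitScaleTilt`, crux K1 «MinimiserStabilityRegPr» stmt-QuantumFields-19200; (β) row `hMcomb₂` of ✓`Prop7HDOfCombRows.hD_of_hMcomb`; def-free, count-neutral,
`--supports stmt-QuantumFields-19200 --as helper`).  Cell `ym3-torus` (HUMAN RULING D-0037, YM ladder rung R3 — YM₃ on T³ is a rung, not d = 4, not infinite volume, not a
mass gap, not Clay), width seat `ym3-torus-px17` (gen 5).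

WHY.  w3-20520 g12's ★★★`Prop7CornerCombH21EOfRows.h21E_of_rows` (M-3 proper v2, `ℤ³`, abstract one-step maps `T`, propagators `P`, windows, periods, currencies) prices the
level-`l` cell `ℓ¹` norm of the second-order defect `E_l = (Ũˡ − 1) − P_{l←0}(iX)♯` by `Am₂(Lˡ)⁻¹ + Bm₂Lˡ`; H-4b ★★★`Prop7CombTildRem2DuhamelT3.sum_norm_rem2_le_duhamel_of_regPr`
(this seat's lineage) is its Duhamel row with TIED sources at the member; M-4b-0 ✓`Prop7CombTildRem2HMcomb2MemberRowsT3` reads every window∕period∕level-0 row off `RegPr` +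
`In19`; M-4a ✓`Prop7CombTildRem2HMcomb2OfCellRowT3.hMcomb₂_of_cellRow` turns the cell row into px13 g6's SIGNATURE-0′ `hMcomb₂`.  THIS FILE is the `exact`: the ONLY displayed
analytic rows left are `hMc` (= the (β) lane's `hMcomb`, per level, torus letters) and `hG` (= (G_j): the per-level cell NORM-GAP energy of `Ỹ_j`, B-slot `Bg·Lʲ`, extensive ONCE —
supplier: the F-lane's covariant-gradient rows, norm gap ≤ covariant gradient).

WHAT IS PROVED (ns `…Theorems.Prop7CombTildRem2HMcomb2MemberT3`; sorry-free):
* ★★★`hEcell_of_hMcomb_of_gap` — at `RegPr F n K ε₀ W` (`10⁸L⁵ε₀ ≤ 1`), `In19 F n K δ W U₁ X` (`δ ≤ ε₀∕6`), `nMax19 W X < ε₀∕6`, for ANY `(T, hT)`, `(P, hP0, hPs)`: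
  `hMc` + `hG` ⟹ M-4a's `hEcell` with `Am₂`, `Bm₂` CLOSED in `(L, ε₀, Am, Bm, Bg, Σ‖X‖², K_W(iX), DIV_W(iX))` (w3's v2 numerals at `Cs := 260((2d+2)L)²`, `c₀ := 1`,
  `E := exp(20321280L⁵ε₀)`, `M := Σ‖X‖²`, `G₀ :=` M-4b-0's level-0 norm-gap row);
* ★★★`hMcomb₂_of_hMcomb_of_gap` — the same hypotheses ⟹ px13 g6's SIGNATURE-0′ `hMcomb₂` row at `A := iX` (M-4a ∘ the above).
HONEST FRAMING.  An instantiation (M); the displayed rows `hMc`, `hG` are OPEN route-internal rows with named suppliers (★routeR-w6 F-8c-final `hMcomb_holds`; the F-lane gradient rows);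
nothing of `hMcomb`∕(G_j)∕(β)∕hPA2∕hcoS∕E′∕EX∕the crux is proved; rung R3, not Clay; the YM mass gap is NOT proved.
References: T. Bałaban, CMP 98 (1985) 17–51 [Balaban1985Averaging] ((42)–(47) pp.23–25, (65)–(69) p.29, Prop. 3 (113)–(126) pp.34–36); CMP 99 (1985) 75–102
[Balaban1985RegularSpaces] (p.77, (1.3), Prop. 7 (1.139)–(1.145) p.100); CMP 102 (1985) 277–309 [Balaban1985Variational] ((2) p.278, (19) p.281, (135) p.298, Prop. 7 p.299);
CMP 109 (1987) 249–301 [Balaban1987RG1] ((0.1) p.251, (0.4) p.253); M. Giaquinta [Giaquinta1984] (Ch. III §1).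
-/

set_option autoImplicit false

noncomputable section

open scoped BigOperators Matrix.Norms.L2Operator

namespace Summit.QuantumFields.YangMills.Theorems.Prop7CombTildRem2HMcomb2MemberT3

open Finset NormedSpace
open Literature.MathematicalPhysics.QuantumFieldTheory.Balaban1983to89
open Literature.MathematicalPhysics.QuantumFieldTheory.Balaban1983to89.T3ContinuumYM3Torus
open T3PrintedRegularMinimiser (RegPr)
open T3SectALandauChart (eta eta_pos bgUnits In19)
open ExpMeanLog (eml)
open B7Prop1Explicit renaming Site → LSite
open B7Prop1Explicit (e seg boxVec gammaWord Wcx Xavg expUnit val_expUnit expRem expRem_le_sq norm_exp_sub_one_le_of_norm_le)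
open B7Prop2Explicit (avgIter unitaryUnits)
open B7Prop3Flat (expCfg)
open B7Eq92Concrete (tildIter tildIter_zero')
open B7Eq106Concrete (avgIter_add)
open B7Prop3GeneralRotated (tsum)
open B9Eq39Adjoint (divB)
open B9TorusCalculus (torusT)
open B10Eq27TorusAxialLog (pull transl unitsField toUField)
open T4TermwiseTorus (tlift)
open B4Eq19LatticeOperators (box)
open Summit.QuantumFields.YangMills.Theorems.Prop7SPrint (basePt)
open Summit.QuantumFields.YangMills.Theorems.Prop7TPrint (nMax19)
open Summit.QuantumFields.YangMills.Theorems.Prop7SymAvgTwFrameDiff (pull_expUnit_eq_expCfg)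
open Summit.QuantumFields.YangMills.Theorems.Prop7CombPeriodCellDict (sum_site_eq_sum_boxVec)
open Summit.QuantumFields.YangMills.Theorems.Prop7CornerCombH21EOfRows (h21E_of_rows)
open Summit.QuantumFields.YangMills.Theorems.Prop7CombTildRem2DuhamelT3 (sum_norm_rem2_le_duhamel_of_regPr rem2_field_zero)
open Summit.QuantumFields.YangMills.Theorems.Prop7CombTildRem2HMcomb2OfCellRowT3 (linTower_texts_of_propagator hMcomb₂_of_cellRow)
open Summit.QuantumFields.YangMills.Theorems.Prop7CombTildRem2HMcomb2MemberRowsT3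
open Summit.QuantumFields.YangMills.Theorems.Prop7CombTowerWindowsOfRegPr (avgIter_pull_mem_unitaryUnits_of_regPr norm_Wcx_avgIter_pull_sub_one_le_level_of_regPr)

section Member

variable (F : T3Family) {n K : ℕ}

/-- ★★★ **THE CELL `ℓ¹` ROW OF THE SECOND-ORDER DEFECT AT THE MEMBER, FROM `hMcomb` AND (G_j)** — M-4a's `hEcell` socket inhabited: at `RegPr F n K ε₀ W` with the single
smallness `10⁸L⁵ε₀ ≤ 1`, `In19 F n K δ W U₁ X` with `δ ≤ ε₀∕6` and `nMax19 W X < ε₀∕6` (the lane's radius convention), for ANY one-step family `(T, hT)` and propagators `(P, hP0, hPs)`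
(H-4b's letters), IF the comb level masses `hMc` (the (β) lane's `hMcomb`, torus letters, every `j < K − n`) and the per-level cell NORM-GAP rows `hG` ((G_j), `≤ Bg·Lʲ`) hold, THEN for
every `l < K − n`: `Σ_{t : Fin d → Fin N_l}Σ_κ ‖E_l(boxVec N_l t, κ)‖ ≤ Am₂·(Lˡ)⁻¹ + Bm₂·Lˡ` with the closed `Am₂`, `Bm₂` displayed below (w3's ★★★`h21E_of_rows` at the member rows of
✓M-4b-0, the Duhamel∕tied-source rows of H-4b, the cell inside `box 0 (N_l − 1)`).
[cite: Balaban1985Averaging, (42)-(47) pp.23-25, (65)-(69) p.29, Prop. 3 (113)-(126) pp.34-36; Balaban1985RegularSpaces, Prop. 7 (1.139)-(1.145) p.100; Balaban1985Variational, (2) p.278, (19) p.281, Prop. 7 p.299] -/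
theorem hEcell_of_hMcomb_of_gap {ε₀ δ : ℝ} (hε₀ : 0 < ε₀) (hε : 10 ^ 8 * (F.L : ℝ) ^ 5 * ε₀ ≤ 1)
    (W : GaugeField (F.P K) 0 (Matrix.specialUnitaryGroup (Fin 2) ℂ)) (hreg : RegPr F n K ε₀ W) (X : PBond (F.P K) 0 → Matrix (Fin 2) (Fin 2) ℂ)
    {U₁ : GaugeField (F.P K) 0 (Matrix.specialUnitaryGroup (Fin 2) ℂ)} (hδ : δ ≤ ε₀ / 6) (h19 : In19 F n K δ W U₁ X) (hX6 : nMax19 F n K W X < ε₀ / 6)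
    (T : ℕ → (LSite (F.P K).d → Fin (F.P K).d → Matrix (Fin 2) (Fin 2) ℂ) → LSite (F.P K).d → Fin (F.P K).d → Matrix (Fin 2) (Fin 2) ℂ)
    (hT : ∀ (k : ℕ) (f : LSite (F.P K).d → Fin (F.P K).d → Matrix (Fin 2) (Fin 2) ℂ) (z : LSite (F.P K).d) (κ : Fin (F.P K).d),
      letI : CStarAlgebra (Matrix (Fin 2) (Fin 2) ℂ) := B10Eq29TubeLine.cstarAlgebraMatrix 2
      T k f z κ
        = fderiv ℂ (eml : ((Fin (F.P K).d → Fin (F.P K).L) → Matrix (Fin 2) (Fin 2) ℂ) → Matrix (Fin 2) (Fin 2) ℂ)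
              (fun r => ((Wcx (F.P K).L (avgIter (F.P K).L (pull (bgUnits F K W) (basePt F n K)) k) (((F.P K).L : ℤ) • z) κ (boxVec (F.P K).L r) : (Matrix (Fin 2) (Fin 2) ℂ)ˣ) : Matrix (Fin 2) (Fin 2) ℂ))
              (fun r => tsum (avgIter (F.P K).L (pull (bgUnits F K W) (basePt F n K)) k) f (((F.P K).L : ℤ) • z) (gammaWord (F.P K).L κ (boxVec (F.P K).L r) ++ seg κ (-((F.P K).L : ℤ)))
                * ((Wcx (F.P K).L (avgIter (F.P K).L (pull (bgUnits F K W) (basePt F n K)) k) (((F.P K).L : ℤ) • z) κ (boxVec (F.P K).L r) : (Matrix (Fin 2) (Fin 2) ℂ)ˣ) : Matrix (Fin 2) (Fin 2) ℂ))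
              * (((expUnit (Xavg (F.P K).L (avgIter (F.P K).L (pull (bgUnits F K W) (basePt F n K)) k) (((F.P K).L : ℤ) • z) κ))⁻¹ : (Matrix (Fin 2) (Fin 2) ℂ)ˣ) : Matrix (Fin 2) (Fin 2) ℂ)
            + ((expUnit (Xavg (F.P K).L (avgIter (F.P K).L (pull (bgUnits F K W) (basePt F n K)) k) (((F.P K).L : ℤ) • z) κ) : (Matrix (Fin 2) (Fin 2) ℂ)ˣ) : Matrix (Fin 2) (Fin 2) ℂ)
                * tsum (avgIter (F.P K).L (pull (bgUnits F K W) (basePt F n K)) k) f (((F.P K).L : ℤ) • z) (seg κ ((F.P K).L : ℤ))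
              * (((expUnit (Xavg (F.P K).L (avgIter (F.P K).L (pull (bgUnits F K W) (basePt F n K)) k) (((F.P K).L : ℤ) • z) κ))⁻¹ : (Matrix (Fin 2) (Fin 2) ℂ)ˣ) : Matrix (Fin 2) (Fin 2) ℂ))
    (P : ℕ → ℕ → (LSite (F.P K).d → Fin (F.P K).d → Matrix (Fin 2) (Fin 2) ℂ) → LSite (F.P K).d → Fin (F.P K).d → Matrix (Fin 2) (Fin 2) ℂ)
    (hP0 : ∀ i f, P i i f = f) (hPs : ∀ l i f, i ≤ l → P (l + 1) i f = T l (P l i f))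
    {Am Bm Bg : ℝ} (hAm : 0 ≤ Am) (hBm : 0 ≤ Bm) (hBg : 0 ≤ Bg)
    (hMc : ∀ j : ℕ, j < K - n →
      ∑ z : Site (F.P K) j, ∑ κ : Fin (F.P K).d,
        ‖((tildIter (F.P K).L (pull (bgUnits F K W) (basePt F n K)) (pull (fun b => expUnit (Complex.I • X b)) (basePt F n K)) (j) (fun μ => ((z μ).val : ℤ)) κ : (Matrix (Fin 2) (Fin 2) ℂ)ˣ) : Matrix (Fin 2) (Fin 2) ℂ) - 1‖ ^ 2 ≤ Am * ((F.L : ℝ) ^ j)⁻¹ + Bm * (F.L : ℝ) ^ j)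
    (hG : ∀ j : ℕ, j < K - n →
      ∑ y : Fin (F.P K).d → Fin ((F.P K).sitesPerDir j), ∑ ν : Fin (F.P K).d, ∑ μ : Fin (F.P K).d,
        (‖((tildIter (F.P K).L (pull (bgUnits F K W) (basePt F n K)) (pull (fun b => expUnit (Complex.I • X b)) (basePt F n K)) (j) (boxVec ((F.P K).sitesPerDir j) y + e μ) ν : (Matrix (Fin 2) (Fin 2) ℂ)ˣ) : Matrix (Fin 2) (Fin 2) ℂ) - 1‖
          - ‖((tildIter (F.P K).L (pull (bgUnits F K W) (basePt F n K)) (pull (fun b => expUnit (Complex.I • X b)) (basePt F n K)) (j) (boxVec ((F.P K).sitesPerDir j) y) ν : (Matrix (Fin 2) (Fin 2) ℂ)ˣ) : Matrix (Fin 2) (Fin 2) ℂ) - 1‖) ^ 2 ≤ Bg * (F.L : ℝ) ^ j) :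
    ∀ l : ℕ, l < K - n →
      ∑ t : Fin (F.P K).d → Fin ((F.P K).sitesPerDir l), ∑ κ : Fin (F.P K).d,
        ‖((((tildIter (F.P K).L (pull (bgUnits F K W) (basePt F n K)) (expCfg fun x μ => Complex.I • X ⟨transl (basePt F n K) x, μ⟩) (l) (boxVec ((F.P K).sitesPerDir l) t) κ : (Matrix (Fin 2) (Fin 2) ℂ)ˣ) : Matrix (Fin 2) (Fin 2) ℂ) - 1) - P (l) 0 (fun x μ => Complex.I • X ⟨transl (basePt F n K) x, μ⟩) (boxVec ((F.P K).sitesPerDir l) t) κ)‖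
      ≤ (Real.exp (20321280 * (F.L : ℝ) ^ 5 * ε₀)) * ((4374 * (260 * ((2 * ((F.P K).d : ℝ) + 2) * ((F.P K).L : ℝ)) ^ 2) + 729 * (1:ℝ)) + (1728 * (260 * ((2 * ((F.P K).d : ℝ) + 2) * ((F.P K).L : ℝ)) ^ 2) + 288 * (1:ℝ)) * (F.P K).L * (2 * ((F.P K).L : ℝ) + 9) ^ 3 * 1 / (((F.P K).L : ℝ) - 1)) * (Am * (((F.P K).L : ℝ) ^ 2 / (((F.P K).L : ℝ) - 1)) + (∑ b : PBond (F.P K) 0, ‖X b‖ ^ 2))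
          * (((F.P K).L : ℝ) ^ l)⁻¹
        + ((Real.exp (20321280 * (F.L : ℝ) ^ 5 * ε₀)) * ((4374 * (260 * ((2 * ((F.P K).d : ℝ) + 2) * ((F.P K).L : ℝ)) ^ 2) + 729 * (1:ℝ)) + (1728 * (260 * ((2 * ((F.P K).d : ℝ) + 2) * ((F.P K).L : ℝ)) ^ 2) + 288 * (1:ℝ)) * (F.P K).L * (2 * ((F.P K).L : ℝ) + 9) ^ 3 * 1 / (((F.P K).L : ℝ) - 1)) * Bm * (((F.P K).L : ℝ) ^ 2 / (((F.P K).L : ℝ) ^ 3 - 1))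
            + (Real.exp (20321280 * (F.L : ℝ) ^ 5 * ε₀)) * ((1728 * (260 * ((2 * ((F.P K).d : ℝ) + 2) * ((F.P K).L : ℝ)) ^ 2) + 288 * (1:ℝ)) * (F.P K).L * (2 * ((F.P K).L : ℝ) + 9) ^ 3) * (13068 * (((F.P K).L : ℝ) + 4) ^ 2) * ((F.P K).L : ℝ) ^ 2 * (Bg / (((F.P K).L : ℝ) - 1) ^ 2 + (2 * (2 * (∑ p : Plaq (F.P K) 0, ‖((Complex.I • X ⟨p.src, p.μ⟩)
          + ((W ⟨p.src, p.μ⟩ : Matrix (Fin 2) (Fin 2) ℂ) * (Complex.I • X ⟨p.src.shift p.μ, p.ν⟩) * star (W ⟨p.src, p.μ⟩ : Matrix (Fin 2) (Fin 2) ℂ))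
          - (((W ⟨p.src, p.μ⟩ * W ⟨p.src.shift p.μ, p.ν⟩ * (W ⟨p.src.shift p.ν, p.μ⟩)⁻¹ : Matrix.specialUnitaryGroup (Fin 2) ℂ) : Matrix (Fin 2) (Fin 2) ℂ)
              * (Complex.I • X ⟨p.src.shift p.ν, p.μ⟩)
              * star ((W ⟨p.src, p.μ⟩ * W ⟨p.src.shift p.μ, p.ν⟩ * (W ⟨p.src.shift p.ν, p.μ⟩)⁻¹ : Matrix.specialUnitaryGroup (Fin 2) ℂ) : Matrix (Fin 2) (Fin 2) ℂ))
          - (((GaugeField.plaqHol W p : Matrix.specialUnitaryGroup (Fin 2) ℂ) : Matrix (Fin 2) (Fin 2) ℂ) * (Complex.I • X ⟨p.src, p.ν⟩)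
              * star ((GaugeField.plaqHol W p : Matrix.specialUnitaryGroup (Fin 2) ℂ) : Matrix (Fin 2) (Fin 2) ℂ)))‖ ^ 2)
          + 32 * 3 * (ε₀ * (((F.L : ℝ) ^ (K - n)) ^ 2)⁻¹) ^ 2 * (∑ b : PBond (F.P K) 0, ‖X b‖ ^ 2))
        + (∑ x : Site (F.P K) 0, ∑ j : Fin 2, ∑ k : Fin 2,
            ‖(divB (torusT (F.P K) 0) (fun κ z => unitsField (toUField W) ⟨z, κ⟩) (fun κ z => Complex.I • X ⟨z, κ⟩) x) j k‖ ^ 2)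
        + 2 * 3 * (ε₀ * (((F.L : ℝ) ^ (K - n)) ^ 2)⁻¹) * (2 * (∑ b : PBond (F.P K) 0, ‖X b‖ ^ 2)))))
          * ((F.P K).L : ℝ) ^ l := by
  letI : CStarAlgebra (Matrix (Fin 2) (Fin 2) ℂ) := B10Eq29TubeLine.cstarAlgebraMatrix 2
  intro l hl
  -- numerals and windows
  obtain ⟨hε4, hε3⟩ := windows_of_ten8 F hε₀.le hε
  have hd3 : (F.P K).d = 3 := T3Family.P_d F K
  have hL2 : 2 ≤ (F.P K).L := (F.P K).hL.2
  have hX : ∀ b : PBond (F.P K) 0, (X b).IsHermitian ∧ (X b).trace = 0 := h19.1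
  have hX1 : ∀ b : PBond (F.P K) 0, ‖X b‖ ≤ 1 := by
    intro b
    have h1 := (h19.2.2.1 b).le
    have hη : eta F n K ≤ 1 := by
      have := Summit.QuantumFields.YangMills.Theorems.Prop7SymAvgTwSym.pow_mul_eta_le_one F (n := n) (K := K) (j := 0) (Nat.zero_le _)
      simpa using this
    have hε1 : ε₀ ≤ 1 := by
      have hL1 : (1 : ℝ) ≤ (F.L : ℝ) ^ 5 := one_le_pow₀ (by exact_mod_cast F.hL.2.le)
      nlinarith
    have hδ1 : δ ≤ 1 := by linarith
    have hη0 : 0 ≤ eta F n K := (eta_pos F n K).le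
    nlinarith [norm_nonneg (X b)]
  have hlK : l ≤ F.m + K := by omega
  -- the period data of level `l`
  set Nl : ℕ := (F.P K).sitesPerDir l with hNl_def
  have hNl0 : Nl ≠ 0 := (F.P K).sitesPerDir_ne_zero l
  have hNl : 1 ≤ Nl := Nat.one_le_iff_ne_zero.mpr hNl0
  haveI : NeZero ((F.P K).sitesPerDir 0) := ⟨(F.P K).sitesPerDir_ne_zero 0⟩
  haveI hNj_inst : ∀ j, NeZero ((fun j => (F.P K).sitesPerDir j) j) := fun j => ⟨(F.P K).sitesPerDir_ne_zero j⟩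
  -- the linearised tower texts of the propagator column and the Duhamel∕tied rows (H-4b)
  obtain ⟨hQ0, hQs⟩ := linTower_texts_of_propagator F (n := n) W T hT P hP0 hPs
  have hDu := sum_norm_rem2_le_duhamel_of_regPr F hε₀ hε4 W hreg X hX hX6 (fun k => P k 0) hQs T hT P hP0 hPs l
    (box (0 : LSite (F.P K).d) ((Nl - 1 : ℕ) : ℤ) ×ˢ (Finset.univ : Finset (Fin (F.P K).d)))
  obtain ⟨hDu1, hDu2⟩ := hDu
  -- (0) letters
  have hpull : (pull (fun b => expUnit (Complex.I • X b)) (basePt F n K)) = (expCfg fun x μ => Complex.I • X ⟨transl (basePt F n K) x, μ⟩) := pull_expUnit_eq_expCfg F (fun b => Complex.I • X b) (basePt F n K)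
  -- (1) the background tower windows (F-8c-3a) at the levels `≤ l`
  have hV₀ : ∀ k, k ≤ l → ∀ (x : LSite (F.P K).d) (μ : Fin (F.P K).d), avgIter (F.P K).L (pull (bgUnits F K W) (basePt F n K)) k x μ ∈ unitaryUnits (Matrix (Fin 2) (Fin 2) ℂ) :=
    fun k hk x μ => avgIter_pull_mem_unitaryUnits_of_regPr F hε₀ hε3 W hreg (by omega) x μ
  have hα₀ : ∀ k, k < l → ∀ (z : LSite (F.P K).d) (κ : Fin (F.P K).d) (r : Fin (F.P K).d → Fin (F.P K).L),
      ‖((Wcx (F.P K).L (avgIter (F.P K).L (pull (bgUnits F K W) (basePt F n K)) k) (((F.P K).L : ℤ) • z) κ (boxVec (F.P K).L r) : (Matrix (Fin 2) (Fin 2) ℂ)ˣ) : Matrix (Fin 2) (Fin 2) ℂ) - 1‖ ≤ (2 * (8 * ((F.P K).d + 1) * ((F.P K).d + 4) * ((F.P K).L : ℝ) ^ 2 * (2 * (2 * ε₀ * ((((F.P K).L : ℝ)) ^ (k) * ((((F.P K).L : ℝ)) ^ (K - n))⁻¹) ^ 2)))) :=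
    fun k hk z κ r => norm_Wcx_avgIter_pull_sub_one_le_level_of_regPr F hε₀ hε3 W hreg (by omega) _ κ r
  have hα₀24 : ∀ k, k < l → (2 * (8 * ((F.P K).d + 1) * ((F.P K).d + 4) * ((F.P K).L : ℝ) ^ 2 * (2 * (2 * ε₀ * ((((F.P K).L : ℝ)) ^ (k) * ((((F.P K).L : ℝ)) ^ (K - n))⁻¹) ^ 2)))) ≤ 1 / 24 := fun k hk => hα24_level F hε₀ hε3 W hreg (by omega)
  have hprod₀ : ∀ i, i ≤ l → ∏ m ∈ Finset.range i, (((F.P K).L : ℝ) * (((F.P K).L : ℝ) ^ (F.P K).d)⁻¹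
        + 2 * (F.P K).d * (210 * (2 * (8 * ((F.P K).d + 1) * ((F.P K).d + 4) * ((F.P K).L : ℝ) ^ 2 * (2 * (2 * ε₀ * ((((F.P K).L : ℝ)) ^ (m) * ((((F.P K).L : ℝ)) ^ (K - n))⁻¹) ^ 2)))) * ((2 * (F.P K).d + 2) * ((F.P K).L : ℝ))))
      ≤ (Real.exp (20321280 * (F.L : ℝ) ^ 5 * ε₀)) * (((((F.L : ℝ) ^ 2) ^ i)⁻¹)) := by
    intro i hi
    have h := prod_weights_le F (n := n) (K := K) hε₀.le (i := i) (j := 0) (by omega)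
    simpa only [Nat.zero_add] using h
  -- (2) the level-0 rows
  have hQ0s : ∀ (k : ℕ) (z : LSite (F.P K).d) (κ : Fin (F.P K).d),
      P (k + 1) 0 (fun x μ => (((tildIter (F.P K).L (pull (bgUnits F K W) (basePt F n K)) (expCfg fun x μ => Complex.I • X ⟨transl (basePt F n K) x, μ⟩) (0) x μ : (Matrix (Fin 2) (Fin 2) ℂ)ˣ) : Matrix (Fin 2) (Fin 2) ℂ) - 1) - P (0) 0 (fun x μ => Complex.I • X ⟨transl (basePt F n K) x, μ⟩) x μ) z κ = fderiv ℂ (eml : ((Fin (F.P K).d → Fin (F.P K).L) → Matrix (Fin 2) (Fin 2) ℂ) → Matrix (Fin 2) (Fin 2) ℂ)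
              (fun r => ((Wcx (F.P K).L (avgIter (F.P K).L (pull (bgUnits F K W) (basePt F n K)) k) (((F.P K).L : ℤ) • z) κ (boxVec (F.P K).L r) : (Matrix (Fin 2) (Fin 2) ℂ)ˣ) : Matrix (Fin 2) (Fin 2) ℂ))
              (fun r => tsum (avgIter (F.P K).L (pull (bgUnits F K W) (basePt F n K)) k) (P k 0 (fun x μ => (((tildIter (F.P K).L (pull (bgUnits F K W) (basePt F n K)) (expCfg fun x μ => Complex.I • X ⟨transl (basePt F n K) x, μ⟩) (0) x μ : (Matrix (Fin 2) (Fin 2) ℂ)ˣ) : Matrix (Fin 2) (Fin 2) ℂ) - 1) - P (0) 0 (fun x μ => Complex.I • X ⟨transl (basePt F n K) x, μ⟩) x μ)) (((F.P K).L : ℤ) • z) (gammaWord (F.P K).L κ (boxVec (F.P K).L r) ++ seg κ (-((F.P K).L : ℤ)))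
                * ((Wcx (F.P K).L (avgIter (F.P K).L (pull (bgUnits F K W) (basePt F n K)) k) (((F.P K).L : ℤ) • z) κ (boxVec (F.P K).L r) : (Matrix (Fin 2) (Fin 2) ℂ)ˣ) : Matrix (Fin 2) (Fin 2) ℂ))
              * (((expUnit (Xavg (F.P K).L (avgIter (F.P K).L (pull (bgUnits F K W) (basePt F n K)) k) (((F.P K).L : ℤ) • z) κ))⁻¹ : (Matrix (Fin 2) (Fin 2) ℂ)ˣ) : Matrix (Fin 2) (Fin 2) ℂ)
            + ((expUnit (Xavg (F.P K).L (avgIter (F.P K).L (pull (bgUnits F K W) (basePt F n K)) k) (((F.P K).L : ℤ) • z) κ) : (Matrix (Fin 2) (Fin 2) ℂ)ˣ) : Matrix (Fin 2) (Fin 2) ℂ)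
                * tsum (avgIter (F.P K).L (pull (bgUnits F K W) (basePt F n K)) k) (P k 0 (fun x μ => (((tildIter (F.P K).L (pull (bgUnits F K W) (basePt F n K)) (expCfg fun x μ => Complex.I • X ⟨transl (basePt F n K) x, μ⟩) (0) x μ : (Matrix (Fin 2) (Fin 2) ℂ)ˣ) : Matrix (Fin 2) (Fin 2) ℂ) - 1) - P (0) 0 (fun x μ => Complex.I • X ⟨transl (basePt F n K) x, μ⟩) x μ)) (((F.P K).L : ℤ) • z) (seg κ ((F.P K).L : ℤ))
              * (((expUnit (Xavg (F.P K).L (avgIter (F.P K).L (pull (bgUnits F K W) (basePt F n K)) k) (((F.P K).L : ℤ) • z) κ))⁻¹ : (Matrix (Fin 2) (Fin 2) ℂ)ˣ) : Matrix (Fin 2) (Fin 2) ℂ) :=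
    fun k z κ => hQs k _ z κ
  have hY0 : ∀ (x : LSite (F.P K).d) (μ : Fin (F.P K).d), ‖((((tildIter (F.P K).L (pull (bgUnits F K W) (basePt F n K)) (expCfg fun x μ => Complex.I • X ⟨transl (basePt F n K) x, μ⟩) (0) x μ : (Matrix (Fin 2) (Fin 2) ℂ)ˣ) : Matrix (Fin 2) (Fin 2) ℂ) - 1) - P (0) 0 (fun x μ => Complex.I • X ⟨transl (basePt F n K) x, μ⟩) x μ)‖ ≤ 1 * ‖Complex.I • X ⟨transl (basePt F n K) x, μ⟩‖ ^ 2 := by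
    intro x μ
    have h0 : ((((tildIter (F.P K).L (pull (bgUnits F K W) (basePt F n K)) (expCfg fun x μ => Complex.I • X ⟨transl (basePt F n K) x, μ⟩) (0) x μ : (Matrix (Fin 2) (Fin 2) ℂ)ˣ) : Matrix (Fin 2) (Fin 2) ℂ) - 1) - P (0) 0 (fun x μ => Complex.I • X ⟨transl (basePt F n K) x, μ⟩) x μ) = NormedSpace.exp (Complex.I • X ⟨transl (basePt F n K) x, μ⟩) - 1 - Complex.I • X ⟨transl (basePt F n K) x, μ⟩ :=
      rem2_field_zero F W X (fun k => P k 0) hQ0 x μ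
    have hB : ‖Complex.I • X ⟨transl (basePt F n K) x, μ⟩‖ ≤ 1 := by rw [norm_smul, Complex.norm_I, one_mul]; exact hX1 _
    rw [h0, one_mul]
    exact (norm_exp_sub_one_le_of_norm_le (le_refl ‖Complex.I • X ⟨transl (basePt F n K) x, μ⟩‖)).2.trans (expRem_le_sq (norm_nonneg _) hB)
  have hper0 : ∀ (x : LSite (F.P K).d) (κ : Fin (F.P K).d),
      (fun μ => Complex.I • X ⟨transl (basePt F n K) (x + (((F.P K).sitesPerDir 0 : ℕ) : ℤ) • e κ), μ⟩) = fun μ => Complex.I • X ⟨transl (basePt F n K) x, μ⟩ :=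
    fun x κ => iX_add_period_T3 F n X x κ
  have hN0 : (F.P K).sitesPerDir 0 = Nl * (F.P K).L ^ l := by
    have h := sitesPerDir_eq_mul_pow_sub F K (Nat.zero_le l) hlK
    rw [Nat.sub_zero] at h; exact h
  have hMX := cellMass_iX_le F n K X
  have hGX := cellGap_iX_le_of_regPr F n K hε₀.le hreg X
  -- (3) the source levels `j < l`: re-based windows
  have hVj : ∀ j, j < l → ∀ k, k ≤ l - 1 - j → ∀ (x : LSite (F.P K).d) (μ : Fin (F.P K).d),
      avgIter (F.P K).L (avgIter (F.P K).L (pull (bgUnits F K W) (basePt F n K)) (j + 1)) k x μ ∈ unitaryUnits (Matrix (Fin 2) (Fin 2) ℂ) :=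
    fun j hj k hk x μ => hV_rebased F hε₀ hε3 W hreg (a := j + 1) (k := k) (by omega) x μ
  have hαj0 : ∀ j k : ℕ, 0 ≤ (2 * (8 * ((F.P K).d + 1) * ((F.P K).d + 4) * ((F.P K).L : ℝ) ^ 2 * (2 * (2 * ε₀ * ((((F.P K).L : ℝ)) ^ (j + 1 + k) * ((((F.P K).L : ℝ)) ^ (K - n))⁻¹) ^ 2)))) := fun j k => alphaLev_nonneg F hε₀.le _
  have hαj : ∀ j, j < l → ∀ k, k < l - 1 - j → ∀ (z : LSite (F.P K).d) (κ : Fin (F.P K).d) (r : Fin (F.P K).d → Fin (F.P K).L),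
      ‖((Wcx (F.P K).L (avgIter (F.P K).L (avgIter (F.P K).L (pull (bgUnits F K W) (basePt F n K)) (j + 1)) k) (((F.P K).L : ℤ) • z) κ (boxVec (F.P K).L r) : (Matrix (Fin 2) (Fin 2) ℂ)ˣ) : Matrix (Fin 2) (Fin 2) ℂ) - 1‖
        ≤ (2 * (8 * ((F.P K).d + 1) * ((F.P K).d + 4) * ((F.P K).L : ℝ) ^ 2 * (2 * (2 * ε₀ * ((((F.P K).L : ℝ)) ^ (j + 1 + k) * ((((F.P K).L : ℝ)) ^ (K - n))⁻¹) ^ 2)))) :=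
    fun j hj k hk z κ r => hα_rebased F hε₀ hε3 W hreg (a := j + 1) (k := k) (by omega) _ κ r
  have hαj24 : ∀ j, j < l → ∀ k, k < l - 1 - j → (2 * (8 * ((F.P K).d + 1) * ((F.P K).d + 4) * ((F.P K).L : ℝ) ^ 2 * (2 * (2 * ε₀ * ((((F.P K).L : ℝ)) ^ (j + 1 + k) * ((((F.P K).L : ℝ)) ^ (K - n))⁻¹) ^ 2)))) ≤ 1 / 24 :=
    fun j hj k hk => hα24_level F hε₀ hε3 W hreg (by omega)
  have hprodj : ∀ j, j < l → ∀ i, i ≤ l - 1 - j → ∏ m ∈ Finset.range i, (((F.P K).L : ℝ) * (((F.P K).L : ℝ) ^ (F.P K).d)⁻¹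
        + 2 * (F.P K).d * (210 * (2 * (8 * ((F.P K).d + 1) * ((F.P K).d + 4) * ((F.P K).L : ℝ) ^ 2 * (2 * (2 * ε₀ * ((((F.P K).L : ℝ)) ^ (j + 1 + m) * ((((F.P K).L : ℝ)) ^ (K - n))⁻¹) ^ 2)))) * ((2 * (F.P K).d + 2) * ((F.P K).L : ℝ))))
      ≤ (Real.exp (20321280 * (F.L : ℝ) ^ 5 * ε₀)) * (((((F.L : ℝ) ^ 2) ^ i)⁻¹)) :=
    fun j hj i hi => prod_weights_le F (n := n) (K := K) hε₀.le (j := j + 1) (i := i) (by omega)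
  -- (4) the sources, their propagator columns and the tied rows (H-4b)
  have hQj0 : ∀ j : ℕ, P (j + 1 + 0) (j + 1) ((fun x μ => (((tildIter (F.P K).L (pull (bgUnits F K W) (basePt F n K)) (expCfg fun x μ => Complex.I • X ⟨transl (basePt F n K) x, μ⟩) (j + 1) x μ : (Matrix (Fin 2) (Fin 2) ℂ)ˣ) : Matrix (Fin 2) (Fin 2) ℂ) - 1) - P (j + 1) 0 (fun x μ => Complex.I • X ⟨transl (basePt F n K) x, μ⟩) x μ) - T j (fun x μ => (((tildIter (F.P K).L (pull (bgUnits F K W) (basePt F n K)) (expCfg fun x μ => Complex.I • X ⟨transl (basePt F n K) x, μ⟩) (j) x μ : (Matrix (Fin 2) (Fin 2) ℂ)ˣ) : Matrix (Fin 2) (Fin 2) ℂ) - 1) - P (j) 0 (fun x μ => Complex.I • X ⟨transl (basePt F n K) x, μ⟩) x μ)) = ((fun x μ => (((tildIter (F.P K).L (pull (bgUnits F K W) (basePt F n K)) (expCfg fun x μ => Complex.I • X ⟨transl (basePt F n K) x, μ⟩) (j + 1) x μ : (Matrix (Fin 2) (Fin 2) ℂ)ˣ) : Matrix (Fin 2)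 (Fin 2) ℂ) - 1) - P (j + 1) 0 (fun x μ => Complex.I • X ⟨transl (basePt F n K) x, μ⟩) x μ) - T j (fun x μ => (((tildIter (F.P K).L (pull (bgUnits F K W) (basePt F n K)) (expCfg fun x μ => Complex.I • X ⟨transl (basePt F n K) x, μ⟩) (j) x μ : (Matrix (Fin 2) (Fin 2) ℂ)ˣ) : Matrix (Fin 2) (Fin 2) ℂ) - 1) - P (j) 0 (fun x μ => Complex.I • X ⟨transl (basePt F n K) x, μ⟩) x μ)) :=
    fun j => hP0 (j + 1) _
  have hQjs : ∀ j, j < l → ∀ (k : ℕ) (z : LSite (F.P K).d) (κ : Fin (F.P K).d),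
      P (j + 1 + (k + 1)) (j + 1) ((fun x μ => (((tildIter (F.P K).L (pull (bgUnits F K W) (basePt F n K)) (expCfg fun x μ => Complex.I • X ⟨transl (basePt F n K) x, μ⟩) (j + 1) x μ : (Matrix (Fin 2) (Fin 2) ℂ)ˣ) : Matrix (Fin 2) (Fin 2) ℂ) - 1) - P (j + 1) 0 (fun x μ => Complex.I • X ⟨transl (basePt F n K) x, μ⟩) x μ) - T j (fun x μ => (((tildIter (F.P K).L (pull (bgUnits F K W) (basePt F n K)) (expCfg fun x μ => Complex.I • X ⟨transl (basePt F n K) x, μ⟩) (j) x μ : (Matrix (Fin 2) (Fin 2) ℂ)ˣ) : Matrix (Fin 2) (Fin 2) ℂ) - 1) - P (j) 0 (fun x μ => Complex.I • X ⟨transl (basePt F n K) x, μ⟩) x μ)) z κ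
        = fderiv ℂ (eml : ((Fin (F.P K).d → Fin (F.P K).L) → Matrix (Fin 2) (Fin 2) ℂ) → Matrix (Fin 2) (Fin 2) ℂ)
              (fun r => ((Wcx (F.P K).L (avgIter (F.P K).L (avgIter (F.P K).L (pull (bgUnits F K W) (basePt F n K)) (j + 1)) k) (((F.P K).L : ℤ) • z) κ (boxVec (F.P K).L r) : (Matrix (Fin 2) (Fin 2) ℂ)ˣ) : Matrix (Fin 2) (Fin 2) ℂ))
              (fun r => tsum (avgIter (F.P K).L (avgIter (F.P K).L (pull (bgUnits F K W) (basePt F n K)) (j + 1)) k) (P (j + 1 + k) (j + 1) ((fun x μ => (((tildIter (F.P K).L (pull (bgUnits F K W) (basePt F n K)) (expCfg fun x μ => Complex.I • X ⟨transl (basePt F n K) x, μ⟩) (j + 1) x μ : (Matrix (Fin 2) (Fin 2) ℂ)ˣ) : Matrix (Fin 2) (Fin 2) ℂ) - 1) - P (j + 1) 0 (fun x μ => Complex.I • X ⟨transl (basePt F n K) x, μ⟩) x μ) - T j (fun x μ => (((tildIter (F.P K).L (pull (bgUnits F K W) (basePt F n K)) (expCfg fun x μ => Complex.I • X ⟨transl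 (basePt F n K) x, μ⟩) (j) x μ : (Matrix (Fin 2) (Fin 2) ℂ)ˣ) : Matrix (Fin 2) (Fin 2) ℂ) - 1) - P (j) 0 (fun x μ => Complex.I • X ⟨transl (basePt F n K) x, μ⟩) x μ))) (((F.P K).L : ℤ) • z) (gammaWord (F.P K).L κ (boxVec (F.P K).L r) ++ seg κ (-((F.P K).L : ℤ)))
                * ((Wcx (F.P K).L (avgIter (F.P K).L (avgIter (F.P K).L (pull (bgUnits F K W) (basePt F n K)) (j + 1)) k) (((F.P K).L : ℤ) • z) κ (boxVec (F.P K).L r) : (Matrix (Fin 2) (Fin 2) ℂ)ˣ) : Matrix (Fin 2) (Fin 2) ℂ))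
              * (((expUnit (Xavg (F.P K).L (avgIter (F.P K).L (avgIter (F.P K).L (pull (bgUnits F K W) (basePt F n K)) (j + 1)) k) (((F.P K).L : ℤ) • z) κ))⁻¹ : (Matrix (Fin 2) (Fin 2) ℂ)ˣ) : Matrix (Fin 2) (Fin 2) ℂ)
            + ((expUnit (Xavg (F.P K).L (avgIter (F.P K).L (avgIter (F.P K).L (pull (bgUnits F K W) (basePt F n K)) (j + 1)) k) (((F.P K).L : ℤ) • z) κ) : (Matrix (Fin 2) (Fin 2) ℂ)ˣ) : Matrix (Fin 2) (Fin 2) ℂ)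
                * tsum (avgIter (F.P K).L (avgIter (F.P K).L (pull (bgUnits F K W) (basePt F n K)) (j + 1)) k) (P (j + 1 + k) (j + 1) ((fun x μ => (((tildIter (F.P K).L (pull (bgUnits F K W) (basePt F n K)) (expCfg fun x μ => Complex.I • X ⟨transl (basePt F n K) x, μ⟩) (j + 1) x μ : (Matrix (Fin 2) (Fin 2) ℂ)ˣ) : Matrix (Fin 2) (Fin 2) ℂ) - 1) - P (j + 1) 0 (fun x μ => Complex.I • X ⟨transl (basePt F n K) x, μ⟩) x μ) - T j (fun x μ => (((tildIter (F.P K).L (pull (bgUnits F K W) (basePt F n K)) (expCfg fun x μ => Complex.I • X ⟨transl (basePt F n K) x, μ⟩) (j) x μ : (Matrix (Fin 2) (Fin 2) ℂ)ˣ) : Matrix (Fin 2) (Fin 2) ℂ) - 1) - P (j) 0 (fun x μ => Complex.I • X ⟨transl (basePt F n K) x, μ⟩) x μ))) (((F.P K).L : ℤ) • z) (seg κ ((F.P K).L : ℤ))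
              * (((expUnit (Xavg (F.P K).L (avgIter (F.P K).L (avgIter (F.P K).L (pull (bgUnits F K W) (basePt F n K)) (j + 1)) k) (((F.P K).L : ℤ) • z) κ))⁻¹ : (Matrix (Fin 2) (Fin 2) ℂ)ˣ) : Matrix (Fin 2) (Fin 2) ℂ) := by
    intro j hj k z κ
    have e1 : P (j + 1 + (k + 1)) (j + 1) ((fun x μ => (((tildIter (F.P K).L (pull (bgUnits F K W) (basePt F n K)) (expCfg fun x μ => Complex.I • X ⟨transl (basePt F n K) x, μ⟩) (j + 1) x μ : (Matrix (Fin 2) (Fin 2) ℂ)ˣ) : Matrix (Fin 2) (Fin 2) ℂ) - 1) - P (j + 1) 0 (fun x μ => Complex.I • X ⟨transl (basePt F n K) x, μ⟩) x μ) - T j (fun x μ => (((tildIter (F.P K).L (pull (bgUnits F K W) (basePt F n K)) (expCfg fun x μ => Complex.I • X ⟨transl (basePt F n K) x, μ⟩) (j) x μ : (Matrix (Fin 2) (Fin 2) ℂ)ˣ) : Matrix (Fin 2) (Fin 2) ℂ) - 1) - P (j) 0 (fun x μ => Complex.I • X ⟨transl (basePt F n K) x, μ⟩) x μ))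
        = T (j + 1 + k) (P (j + 1 + k) (j + 1) ((fun x μ => (((tildIter (F.P K).L (pull (bgUnits F K W) (basePt F n K)) (expCfg fun x μ => Complex.I • X ⟨transl (basePt F n K) x, μ⟩) (j + 1) x μ : (Matrix (Fin 2) (Fin 2) ℂ)ˣ) : Matrix (Fin 2) (Fin 2) ℂ) - 1) - P (j + 1) 0 (fun x μ => Complex.I • X ⟨transl (basePt F n K) x, μ⟩) x μ) - T j (fun x μ => (((tildIter (F.P K).L (pull (bgUnits F K W) (basePt F n K)) (expCfg fun x μ => Complex.I • X ⟨transl (basePt F n K) x, μ⟩) (j) x μ : (Matrix (Fin 2) (Fin 2) ℂ)ˣ) : Matrix (Fin 2) (Fin 2) ℂ) - 1) - P (j) 0 (fun x μ => Complex.I • X ⟨transl (basePt F n K) x, μ⟩) x μ))) := hPs (j + 1 + k) (j + 1) _ (by omega)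
    rw [e1, hT, avgIter_add]
  have hsj : ∀ j, j < l → ∀ (y : LSite (F.P K).d) (κ : Fin (F.P K).d),
      ‖((fun x μ => (((tildIter (F.P K).L (pull (bgUnits F K W) (basePt F n K)) (expCfg fun x μ => Complex.I • X ⟨transl (basePt F n K) x, μ⟩) (j + 1) x μ : (Matrix (Fin 2) (Fin 2) ℂ)ˣ) : Matrix (Fin 2) (Fin 2) ℂ) - 1) - P (j + 1) 0 (fun x μ => Complex.I • X ⟨transl (basePt F n K) x, μ⟩) x μ) - T j (fun x μ => (((tildIter (F.P K).L (pull (bgUnits F K W) (basePt F n K)) (expCfg fun x μ => Complex.I • X ⟨transl (basePt F n K) x, μ⟩) (j) x μ : (Matrix (Fin 2) (Fin 2) ℂ)ˣ) : Matrix (Fin 2) (Fin 2) ℂ) - 1) - P (j) 0 (fun x μ => Complex.I • X ⟨transl (basePt F n K) x, μ⟩) x μ)) y κ‖ ≤ (260 * ((2 * ((F.P K).d : ℝ) + 2) * ((F.P K).L : ℝ)) ^ 2) * ∑ σ : Fin (F.P K).d → Fin (F.P K).L, ∑ ν : Fin (F.P K).d,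
        (‖((tildIter (F.P K).L (pull (bgUnits F K W) (basePt F n K)) (expCfg fun x μ => Complex.I • X ⟨transl (basePt F n K) x, μ⟩) (j) (((F.P K).L : ℤ) • y + boxVec (F.P K).L σ) ν : (Matrix (Fin 2) (Fin 2) ℂ)ˣ) : Matrix (Fin 2) (Fin 2) ℂ) - 1‖ ^ 2 + ‖((tildIter (F.P K).L (pull (bgUnits F K W) (basePt F n K)) (expCfg fun x μ => Complex.I • X ⟨transl (basePt F n K) x, μ⟩) (j) (((F.P K).L : ℤ) • y + ((F.P K).L : ℤ) • e κ + boxVec (F.P K).L σ) ν : (Matrix (Fin 2) (Fin 2) ℂ)ˣ) : Matrix (Fin 2) (Fin 2) ℂ) - 1‖ ^ 2) := by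
    intro j hj y κ
    have h := hDu2 j (by omega) y κ
    rw [← mul_assoc] at h
    exact h
  have hperj : ∀ j, j < l → ∀ (x : LSite (F.P K).d) (κ : Fin (F.P K).d),
      (fun ν => ((tildIter (F.P K).L (pull (bgUnits F K W) (basePt F n K)) (expCfg fun x μ => Complex.I • X ⟨transl (basePt F n K) x, μ⟩) (j) (x + (((F.P K).sitesPerDir j : ℕ) : ℤ) • e κ) ν : (Matrix (Fin 2) (Fin 2) ℂ)ˣ) : Matrix (Fin 2) (Fin 2) ℂ) - 1) = fun ν => ((tildIter (F.P K).L (pull (bgUnits F K W) (basePt F n K)) (expCfg fun x μ => Complex.I • X ⟨transl (basePt F n K) x, μ⟩) (j) x ν : (Matrix (Fin 2) (Fin 2) ℂ)ˣ) : Matrix (Fin 2) (Fin 2) ℂ) - 1 :=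
    fun j hj x κ => tildIter_add_period_T3 F n W X (j := j) (by omega) x κ
  have hNj : ∀ j, j < l → (F.P K).sitesPerDir j = Nl * (F.P K).L ^ (l - 1 - j + 1) := by
    intro j hj
    have h := sitesPerDir_eq_mul_pow_sub F K (show j ≤ l by omega) hlK
    rw [show l - 1 - j + 1 = l - j by omega]; exact h
  -- (5) the currencies at the source levels: `hMcomb` read on the cell, and (G_j)
  have hMc' : ∀ j, j < l → ∑ y : Fin (F.P K).d → Fin ((F.P K).sitesPerDir j), ∑ ν : Fin (F.P K).d,
      ‖((tildIter (F.P K).L (pull (bgUnits F K W) (basePt F n K)) (expCfg fun x μ => Complex.I • X ⟨transl (basePt F n K) x, μ⟩) (j) (boxVec ((F.P K).sitesPerDir j) y) ν : (Matrix (Fin 2) (Fin 2) ℂ)ˣ) : Matrix (Fin 2) (Fin 2) ℂ) - 1‖ ^ 2 ≤ Am * (((F.P K).L : ℝ) ^ j)⁻¹ + Bm * ((F.P K).L : ℝ) ^ j := by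
    intro j hj
    have h := hMc j (by omega)
    rw [hpull] at h
    have hcell := sum_site_eq_sum_boxVec (P := F.P K) (l := j) (N := (F.P K).sitesPerDir j) rfl
      (fun x => ∑ κ : Fin (F.P K).d, ‖((tildIter (F.P K).L (pull (bgUnits F K W) (basePt F n K)) (expCfg fun x μ => Complex.I • X ⟨transl (basePt F n K) x, μ⟩) (j) x κ : (Matrix (Fin 2) (Fin 2) ℂ)ˣ) : Matrix (Fin 2) (Fin 2) ℂ) - 1‖ ^ 2)
    rw [← hcell]
    exact h
  have hGc' : ∀ j, j < l → ∑ y : Fin (F.P K).d → Fin ((F.P K).sitesPerDir j), ∑ ν : Fin (F.P K).d, ∑ μ : Fin (F.P K).d,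
      (‖((tildIter (F.P K).L (pull (bgUnits F K W) (basePt F n K)) (expCfg fun x μ => Complex.I • X ⟨transl (basePt F n K) x, μ⟩) (j) (boxVec ((F.P K).sitesPerDir j) y + e μ) ν : (Matrix (Fin 2) (Fin 2) ℂ)ˣ) : Matrix (Fin 2) (Fin 2) ℂ) - 1‖ - ‖((tildIter (F.P K).L (pull (bgUnits F K W) (basePt F n K)) (expCfg fun x μ => Complex.I • X ⟨transl (basePt F n K) x, μ⟩) (j) (boxVec ((F.P K).sitesPerDir j) y) ν : (Matrix (Fin 2) (Fin 2) ℂ)ˣ) : Matrix (Fin 2) (Fin 2) ℂ) - 1‖) ^ 2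
        ≤ Bg * ((F.P K).L : ℝ) ^ j := by
    intro j hj
    have h := hG j (by omega)
    rw [hpull] at h
    exact h
  -- (6) the Duhamel row on the box (H-4b .1 at `Z := box 0 (N_l − 1) × Fin d`)
  have hDuh : ∑ z ∈ box (0 : LSite (F.P K).d) ((Nl - 1 : ℕ) : ℤ), ∑ κ : Fin (F.P K).d, ‖((((tildIter (F.P K).L (pull (bgUnits F K W) (basePt F n K)) (expCfg fun x μ => Complex.I • X ⟨transl (basePt F n K) x, μ⟩) (l) z κ : (Matrix (Fin 2) (Fin 2) ℂ)ˣ) : Matrix (Fin 2) (Fin 2) ℂ) - 1) - P (l) 0 (fun x μ => Complex.I • X ⟨transl (basePt F n K) x, μ⟩) z κ)‖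
      ≤ ∑ z ∈ box (0 : LSite (F.P K).d) ((Nl - 1 : ℕ) : ℤ), ∑ κ : Fin (F.P K).d, ‖P l 0 (fun x μ => (((tildIter (F.P K).L (pull (bgUnits F K W) (basePt F n K)) (expCfg fun x μ => Complex.I • X ⟨transl (basePt F n K) x, μ⟩) (0) x μ : (Matrix (Fin 2) (Fin 2) ℂ)ˣ) : Matrix (Fin 2) (Fin 2) ℂ) - 1) - P (0) 0 (fun x μ => Complex.I • X ⟨transl (basePt F n K) x, μ⟩) x μ) z κ‖
        + ∑ j ∈ Finset.range l, ∑ z ∈ box (0 : LSite (F.P K).d) ((Nl - 1 : ℕ) : ℤ), ∑ κ : Fin (F.P K).d,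
            ‖P (j + 1 + (l - 1 - j)) (j + 1) ((fun x μ => (((tildIter (F.P K).L (pull (bgUnits F K W) (basePt F n K)) (expCfg fun x μ => Complex.I • X ⟨transl (basePt F n K) x, μ⟩) (j + 1) x μ : (Matrix (Fin 2) (Fin 2) ℂ)ˣ) : Matrix (Fin 2) (Fin 2) ℂ) - 1) - P (j + 1) 0 (fun x μ => Complex.I • X ⟨transl (basePt F n K) x, μ⟩) x μ) - T j (fun x μ => (((tildIter (F.P K).L (pull (bgUnits F K W) (basePt F n K)) (expCfg fun x μ => Complex.I • X ⟨transl (basePt F n K) x, μ⟩) (j) x μ : (Matrix (Fin 2) (Fin 2) ℂ)ˣ) : Matrix (Fin 2) (Fin 2) ℂ) - 1) - P (j) 0 (fun x μ => Complex.I • X ⟨transl (basePt F n K) x, μ⟩) x μ)) z κ‖ := by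
    simp only [Finset.sum_product] at hDu1
    refine hDu1.trans (le_of_eq ?_)
    refine congrArg₂ (· + ·) rfl ?_
    refine Finset.sum_congr rfl fun j hj => ?_
    have hjl := Finset.mem_range.mp hj
    rw [show j + 1 + (l - 1 - j) = l by omega]
  -- (7) w3's assembly at the member rows
  have main := h21E_of_rows hd3 (F.P K).L hL2 l Nl hNl (0 : LSite (F.P K).d) (Nl - 1) (by omega)
    (E := (Real.exp (20321280 * (F.L : ℝ) ^ 5 * ε₀))) (Cs := (260 * ((2 * ((F.P K).d : ℝ) + 2) * ((F.P K).L : ℝ)) ^ 2)) (c₀ := (1 : ℝ)) (Am := Am) (Bm := Bm) (Bg := Bg) (M := (∑ b : PBond (F.P K) 0, ‖X b‖ ^ 2)) (G₀ := (2 * (2 * (∑ p : Plaq (F.P K) 0, ‖((Complex.I • X ⟨p.src, p.μ⟩)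
          + ((W ⟨p.src, p.μ⟩ : Matrix (Fin 2) (Fin 2) ℂ) * (Complex.I • X ⟨p.src.shift p.μ, p.ν⟩) * star (W ⟨p.src, p.μ⟩ : Matrix (Fin 2) (Fin 2) ℂ))
          - (((W ⟨p.src, p.μ⟩ * W ⟨p.src.shift p.μ, p.ν⟩ * (W ⟨p.src.shift p.ν, p.μ⟩)⁻¹ : Matrix.specialUnitaryGroup (Fin 2) ℂ) : Matrix (Fin 2) (Fin 2) ℂ)
              * (Complex.I • X ⟨p.src.shift p.ν, p.μ⟩)
              * star ((W ⟨p.src, p.μ⟩ * W ⟨p.src.shift p.μ, p.ν⟩ * (W ⟨p.src.shift p.ν, p.μ⟩)⁻¹ : Matrix.specialUnitaryGroup (Fin 2) ℂ) : Matrix (Fin 2) (Fin 2) ℂ))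
          - (((GaugeField.plaqHol W p : Matrix.specialUnitaryGroup (Fin 2) ℂ) : Matrix (Fin 2) (Fin 2) ℂ) * (Complex.I • X ⟨p.src, p.ν⟩)
              * star ((GaugeField.plaqHol W p : Matrix.specialUnitaryGroup (Fin 2) ℂ) : Matrix (Fin 2) (Fin 2) ℂ)))‖ ^ 2)
          + 32 * 3 * (ε₀ * (((F.L : ℝ) ^ (K - n)) ^ 2)⁻¹) ^ 2 * (∑ b : PBond (F.P K) 0, ‖X b‖ ^ 2))
        + (∑ x : Site (F.P K) 0, ∑ j : Fin 2, ∑ k : Fin 2,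
            ‖(divB (torusT (F.P K) 0) (fun κ z => unitsField (toUField W) ⟨z, κ⟩) (fun κ z => Complex.I • X ⟨z, κ⟩) x) j k‖ ^ 2)
        + 2 * 3 * (ε₀ * (((F.L : ℝ) ^ (K - n)) ^ 2)⁻¹) * (2 * (∑ b : PBond (F.P K) 0, ‖X b‖ ^ 2))))
    (Real.exp_pos _).le (by positivity) zero_le_one hAm hBm hBg
    (fun x μ => (((tildIter (F.P K).L (pull (bgUnits F K W) (basePt F n K)) (expCfg fun x μ => Complex.I • X ⟨transl (basePt F n K) x, μ⟩) (l) x μ : (Matrix (Fin 2) (Fin 2) ℂ)ˣ) : Matrix (Fin 2) (Fin 2) ℂ) - 1) - P (l) 0 (fun x μ => Complex.I • X ⟨transl (basePt F n K) x, μ⟩) x μ)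
    (pull (bgUnits F K W) (basePt F n K)) (fun k => (2 * (8 * ((F.P K).d + 1) * ((F.P K).d + 4) * ((F.P K).L : ℝ) ^ 2 * (2 * (2 * ε₀ * ((((F.P K).L : ℝ)) ^ (k) * ((((F.P K).L : ℝ)) ^ (K - n))⁻¹) ^ 2))))) hV₀ (fun k => alphaLev_nonneg F hε₀.le k) hα₀ hα₀24 hprod₀
    (fun x μ => (((tildIter (F.P K).L (pull (bgUnits F K W) (basePt F n K)) (expCfg fun x μ => Complex.I • X ⟨transl (basePt F n K) x, μ⟩) (0) x μ : (Matrix (Fin 2) (Fin 2) ℂ)ˣ) : Matrix (Fin 2) (Fin 2) ℂ) - 1) - P (0) 0 (fun x μ => Complex.I • X ⟨transl (basePt F n K) x, μ⟩) x μ) (fun k => P k 0) (hP0 0 _) hQ0s (fun x μ => Complex.I • X ⟨transl (basePt F n K) x, μ⟩) hY0 ((F.P K).sitesPerDir 0) hper0 hN0 hMX hGX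
    (fun j => avgIter (F.P K).L (pull (bgUnits F K W) (basePt F n K)) (j + 1)) (fun j k => (2 * (8 * ((F.P K).d + 1) * ((F.P K).d + 4) * ((F.P K).L : ℝ) ^ 2 * (2 * (2 * ε₀ * ((((F.P K).L : ℝ)) ^ (j + 1 + k) * ((((F.P K).L : ℝ)) ^ (K - n))⁻¹) ^ 2))))) hVj hαj0 hαj hαj24 hprodj
    (fun j => (fun x μ => (((tildIter (F.P K).L (pull (bgUnits F K W) (basePt F n K)) (expCfg fun x μ => Complex.I • X ⟨transl (basePt F n K) x, μ⟩) (j + 1) x μ : (Matrix (Fin 2) (Fin 2) ℂ)ˣ) : Matrix (Fin 2) (Fin 2) ℂ) - 1) - P (j + 1) 0 (fun x μ => Complex.I • X ⟨transl (basePt F n K) x, μ⟩) x μ) - T j (fun x μ => (((tildIter (F.P K).L (pull (bgUnits F K W) (basePt F n K)) (expCfg fun x μ => Complex.I • X ⟨transl (basePt F n K) x, μ⟩) (j) x μ : (Matrix (Fin 2) (Fin 2) ℂ)ˣ) : Matrix (Fin 2) (Fin 2) ℂ) - 1) - P (j) 0 (fun x μ => Complex.I • X ⟨transl (basePt F n K)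 x, μ⟩) x μ)) (fun j k f => P (j + 1 + k) (j + 1) f) hQj0 hQjs
    (fun j => (fun x ν => ((tildIter (F.P K).L (pull (bgUnits F K W) (basePt F n K)) (expCfg fun x μ => Complex.I • X ⟨transl (basePt F n K) x, μ⟩) (j) x ν : (Matrix (Fin 2) (Fin 2) ℂ)ˣ) : Matrix (Fin 2) (Fin 2) ℂ) - 1)) hsj (fun j => (F.P K).sitesPerDir j) hperj hNj hMc' hGc' hDuh
  -- (8) the cell inside the box
  have hcellbox := sum_cell_le_sum_box Nl (fun z => ∑ κ : Fin (F.P K).d, ‖((((tildIter (F.P K).L (pull (bgUnits F K W) (basePt F n K)) (expCfg fun x μ => Complex.I • X ⟨transl (basePt F n K) x, μ⟩) (l) z κ : (Matrix (Fin 2) (Fin 2) ℂ)ˣ) : Matrix (Fin 2) (Fin 2) ℂ) - 1) - P (l) 0 (fun x μ => Complex.I • X ⟨transl (basePt F n K) x, μ⟩) z κ)‖) (fun z => by positivity)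
  have hcast : (((Nl - 1 : ℕ) : ℤ)) = (Nl : ℤ) - 1 := by omega
  rw [hcast] at main
  exact hcellbox.trans main


/-- ★★★ **`hMcomb₂` AT THE MEMBER FROM `hMcomb` AND (G_j)** — px13 g6's SIGNATURE-0′ row `hMcomb₂` (the `hMc₂` hypothesis of G3 ✓`Prop7HDOfCombRows.hD_of_hMcomb`, per member) with
`Am₂`, `Bm₂` CLOSED in `(L, ε₀, Am, Bm, Bg, Σ‖X‖², K_W(iX), DIV_W(iX))`: M-4a ✓`hMcomb₂_of_cellRow` ∘ `hEcell_of_hMcomb_of_gap`.  The two displayed rows `hMc` (comb level masses = the (β)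
lane's `hMcomb`) and `hG` ((G_j) = per-level cell norm-gap energies, B-slot) are OPEN route-internal rows with named suppliers; every other input is `RegPr` + `In19`.
[cite: Balaban1985Averaging, (65)-(69) p.29, Prop. 3 (113)-(126) pp.34-36, (119) p.35; Balaban1985RegularSpaces, Prop. 7 (1.139)-(1.145) p.100; Balaban1985Variational, (19) p.281, Prop. 7 p.299; Balaban1987RG1, (0.4) p.253] -/
theorem hMcomb₂_of_hMcomb_of_gap {ε₀ δ : ℝ} (hε₀ : 0 < ε₀) (hε : 10 ^ 8 * (F.L : ℝ) ^ 5 * ε₀ ≤ 1)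
    (W : GaugeField (F.P K) 0 (Matrix.specialUnitaryGroup (Fin 2) ℂ)) (hreg : RegPr F n K ε₀ W) (X : PBond (F.P K) 0 → Matrix (Fin 2) (Fin 2) ℂ)
    {U₁ : GaugeField (F.P K) 0 (Matrix.specialUnitaryGroup (Fin 2) ℂ)} (hδ : δ ≤ ε₀ / 6) (h19 : In19 F n K δ W U₁ X) (hX6 : nMax19 F n K W X < ε₀ / 6)
    (T : ℕ → (LSite (F.P K).d → Fin (F.P K).d → Matrix (Fin 2) (Fin 2) ℂ) → LSite (F.P K).d → Fin (F.P K).d → Matrix (Fin 2) (Fin 2) ℂ)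
    (hT : ∀ (k : ℕ) (f : LSite (F.P K).d → Fin (F.P K).d → Matrix (Fin 2) (Fin 2) ℂ) (z : LSite (F.P K).d) (κ : Fin (F.P K).d),
      letI : CStarAlgebra (Matrix (Fin 2) (Fin 2) ℂ) := B10Eq29TubeLine.cstarAlgebraMatrix 2
      T k f z κ
        = fderiv ℂ (eml : ((Fin (F.P K).d → Fin (F.P K).L) → Matrix (Fin 2) (Fin 2) ℂ) → Matrix (Fin 2) (Fin 2) ℂ)
              (fun r => ((Wcx (F.P K).L (avgIter (F.P K).L (pull (bgUnits F K W) (basePt F n K)) k) (((F.P K).L : ℤ) • z) κ (boxVec (F.P K).L r) : (Matrix (Fin 2) (Fin 2) ℂ)ˣ) : Matrix (Fin 2) (Fin 2) ℂ))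
              (fun r => tsum (avgIter (F.P K).L (pull (bgUnits F K W) (basePt F n K)) k) f (((F.P K).L : ℤ) • z) (gammaWord (F.P K).L κ (boxVec (F.P K).L r) ++ seg κ (-((F.P K).L : ℤ)))
                * ((Wcx (F.P K).L (avgIter (F.P K).L (pull (bgUnits F K W) (basePt F n K)) k) (((F.P K).L : ℤ) • z) κ (boxVec (F.P K).L r) : (Matrix (Fin 2) (Fin 2) ℂ)ˣ) : Matrix (Fin 2) (Fin 2) ℂ))
              * (((expUnit (Xavg (F.P K).L (avgIter (F.P K).L (pull (bgUnits F K W) (basePt F n K)) k) (((F.P K).L : ℤ) • z) κ))⁻¹ : (Matrix (Fin 2) (Fin 2) ℂ)ˣ) : Matrix (Fin 2) (Fin 2) ℂ)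
            + ((expUnit (Xavg (F.P K).L (avgIter (F.P K).L (pull (bgUnits F K W) (basePt F n K)) k) (((F.P K).L : ℤ) • z) κ) : (Matrix (Fin 2) (Fin 2) ℂ)ˣ) : Matrix (Fin 2) (Fin 2) ℂ)
                * tsum (avgIter (F.P K).L (pull (bgUnits F K W) (basePt F n K)) k) f (((F.P K).L : ℤ) • z) (seg κ ((F.P K).L : ℤ))
              * (((expUnit (Xavg (F.P K).L (avgIter (F.P K).L (pull (bgUnits F K W) (basePt F n K)) k) (((F.P K).L : ℤ) • z) κ))⁻¹ : (Matrix (Fin 2) (Fin 2) ℂ)ˣ) : Matrix (Fin 2) (Fin 2) ℂ))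
    (P : ℕ → ℕ → (LSite (F.P K).d → Fin (F.P K).d → Matrix (Fin 2) (Fin 2) ℂ) → LSite (F.P K).d → Fin (F.P K).d → Matrix (Fin 2) (Fin 2) ℂ)
    (hP0 : ∀ i f, P i i f = f) (hPs : ∀ l i f, i ≤ l → P (l + 1) i f = T l (P l i f))
    {Am Bm Bg : ℝ} (hAm : 0 ≤ Am) (hBm : 0 ≤ Bm) (hBg : 0 ≤ Bg)
    (hMc : ∀ j : ℕ, j < K - n →
      ∑ z : Site (F.P K) j, ∑ κ : Fin (F.P K).d,
        ‖((tildIter (F.P K).L (pull (bgUnits F K W) (basePt F n K)) (pull (fun b => expUnit (Complex.I • X b)) (basePt F n K)) (j) (fun μ => ((z μ).val : ℤ)) κ : (Matrix (Fin 2) (Fin 2) ℂ)ˣ) : Matrix (Fin 2) (Fin 2) ℂ) - 1‖ ^ 2 ≤ Am * ((F.L : ℝ) ^ j)⁻¹ + Bm * (F.L : ℝ) ^ j)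
    (hG : ∀ j : ℕ, j < K - n →
      ∑ y : Fin (F.P K).d → Fin ((F.P K).sitesPerDir j), ∑ ν : Fin (F.P K).d, ∑ μ : Fin (F.P K).d,
        (‖((tildIter (F.P K).L (pull (bgUnits F K W) (basePt F n K)) (pull (fun b => expUnit (Complex.I • X b)) (basePt F n K)) (j) (boxVec ((F.P K).sitesPerDir j) y + e μ) ν : (Matrix (Fin 2) (Fin 2) ℂ)ˣ) : Matrix (Fin 2) (Fin 2) ℂ) - 1‖
          - ‖((tildIter (F.P K).L (pull (bgUnits F K W) (basePt F n K)) (pull (fun b => expUnit (Complex.I • X b)) (basePt F n K)) (j) (boxVec ((F.P K).sitesPerDir j) y) ν : (Matrix (Fin 2) (Fin 2) ℂ)ˣ) : Matrix (Fin 2) (Fin 2) ℂ) - 1‖) ^ 2 ≤ Bg * (F.L : ℝ) ^ j) :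
    ∀ l : ℕ, l < K - n →
      ∑ z : Site (F.P K) l, ∑ κ : Fin (F.P K).d,
        ‖((tildIter (F.P K).L (pull (bgUnits F K W) (basePt F n K)) (pull (fun b => expUnit (Complex.I • X b)) (basePt F n K)) (l) (fun μ => ((z μ).val : ℤ)) κ : (Matrix (Fin 2) (Fin 2) ℂ)ˣ) : Matrix (Fin 2) (Fin 2) ℂ) - 1
            - (fderiv ℂ (fun A' : PBond (F.P K) 0 → Matrix (Fin 2) (Fin 2) ℂ =>
                ((tildIter (F.P K).L (pull (bgUnits F K W) (basePt F n K)) (pull (fun b => expUnit (A' b)) (basePt F n K)) l (fun μ => ((z μ).val : ℤ)) κ :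
                  (Matrix (Fin 2) (Fin 2) ℂ)ˣ) : Matrix (Fin 2) (Fin 2) ℂ)) 0) (fun b => Complex.I • X b)‖
      ≤ (Real.exp (20321280 * (F.L : ℝ) ^ 5 * ε₀)) * ((4374 * (260 * ((2 * ((F.P K).d : ℝ) + 2) * ((F.P K).L : ℝ)) ^ 2) + 729 * (1:ℝ)) + (1728 * (260 * ((2 * ((F.P K).d : ℝ) + 2) * ((F.P K).L : ℝ)) ^ 2) + 288 * (1:ℝ)) * (F.P K).L * (2 * ((F.P K).L : ℝ) + 9) ^ 3 * 1 / (((F.P K).L : ℝ) - 1)) * (Am * (((F.P K).L : ℝ) ^ 2 / (((F.P K).L : ℝ) - 1)) + (∑ b : PBond (F.P K) 0, ‖X b‖ ^ 2))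
          * (((F.P K).L : ℝ) ^ l)⁻¹
        + ((Real.exp (20321280 * (F.L : ℝ) ^ 5 * ε₀)) * ((4374 * (260 * ((2 * ((F.P K).d : ℝ) + 2) * ((F.P K).L : ℝ)) ^ 2) + 729 * (1:ℝ)) + (1728 * (260 * ((2 * ((F.P K).d : ℝ) + 2) * ((F.P K).L : ℝ)) ^ 2) + 288 * (1:ℝ)) * (F.P K).L * (2 * ((F.P K).L : ℝ) + 9) ^ 3 * 1 / (((F.P K).L : ℝ) - 1)) * Bm * (((F.P K).L : ℝ) ^ 2 / (((F.P K).L : ℝ) ^ 3 - 1))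
            + (Real.exp (20321280 * (F.L : ℝ) ^ 5 * ε₀)) * ((1728 * (260 * ((2 * ((F.P K).d : ℝ) + 2) * ((F.P K).L : ℝ)) ^ 2) + 288 * (1:ℝ)) * (F.P K).L * (2 * ((F.P K).L : ℝ) + 9) ^ 3) * (13068 * (((F.P K).L : ℝ) + 4) ^ 2) * ((F.P K).L : ℝ) ^ 2 * (Bg / (((F.P K).L : ℝ) - 1) ^ 2 + (2 * (2 * (∑ p : Plaq (F.P K) 0, ‖((Complex.I • X ⟨p.src, p.μ⟩)
          + ((W ⟨p.src, p.μ⟩ : Matrix (Fin 2) (Fin 2) ℂ) * (Complex.I • X ⟨p.src.shift p.μ, p.ν⟩) * star (W ⟨p.src, p.μ⟩ : Matrix (Fin 2) (Fin 2) ℂ))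
          - (((W ⟨p.src, p.μ⟩ * W ⟨p.src.shift p.μ, p.ν⟩ * (W ⟨p.src.shift p.ν, p.μ⟩)⁻¹ : Matrix.specialUnitaryGroup (Fin 2) ℂ) : Matrix (Fin 2) (Fin 2) ℂ)
              * (Complex.I • X ⟨p.src.shift p.ν, p.μ⟩)
              * star ((W ⟨p.src, p.μ⟩ * W ⟨p.src.shift p.μ, p.ν⟩ * (W ⟨p.src.shift p.ν, p.μ⟩)⁻¹ : Matrix.specialUnitaryGroup (Fin 2) ℂ) : Matrix (Fin 2) (Fin 2) ℂ))
          - (((GaugeField.plaqHol W p : Matrix.specialUnitaryGroup (Fin 2) ℂ) : Matrix (Fin 2) (Fin 2) ℂ) * (Complex.I • X ⟨p.src, p.ν⟩)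
              * star ((GaugeField.plaqHol W p : Matrix.specialUnitaryGroup (Fin 2) ℂ) : Matrix (Fin 2) (Fin 2) ℂ)))‖ ^ 2)
          + 32 * 3 * (ε₀ * (((F.L : ℝ) ^ (K - n)) ^ 2)⁻¹) ^ 2 * (∑ b : PBond (F.P K) 0, ‖X b‖ ^ 2))
        + (∑ x : Site (F.P K) 0, ∑ j : Fin 2, ∑ k : Fin 2,
            ‖(divB (torusT (F.P K) 0) (fun κ z => unitsField (toUField W) ⟨z, κ⟩) (fun κ z => Complex.I • X ⟨z, κ⟩) x) j k‖ ^ 2)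
        + 2 * 3 * (ε₀ * (((F.L : ℝ) ^ (K - n)) ^ 2)⁻¹) * (2 * (∑ b : PBond (F.P K) 0, ‖X b‖ ^ 2)))))
          * ((F.P K).L : ℝ) ^ l := by
  obtain ⟨hε4, -⟩ := windows_of_ten8 F hε₀.le hε
  exact hMcomb₂_of_cellRow F hε₀ hε4 W hreg X T hT P hP0 hPs
    (hEcell_of_hMcomb_of_gap F hε₀ hε W hreg X hδ h19 hX6 T hT P hP0 hPs hAm hBm hBg hMc hG)

end Member

end Summit.QuantumFields.YangMills.Theorems.Prop7CombTildRem2HMcomb2MemberT3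

end
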